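import Summits.BirchSwinnertonDyer.BirchSwinnertonDyer.Theorems.ErratumRoadFiveRegCertKernelFiveChecker
import HarnessLib

/-!
# Route `ErratumRoadFive` (rung K2, `p ≥ 5`), crux `RamNoErratumDataAtFive` (item stmt-BirchSwinnertonDyer-19624, REST‴):
# the depth-two REG5CERT checker at PRECISION FOUR (`v₅(h(Q)) = 3`): the Tamagawa-forced case
# (cell `bsd-stepL`, OWNER seat `bsd-stepL-rest-p2` g7; `--supports stmt-BirchSwinnertonDyer-19624`)

HONEST FRAMING: BSD is not proved by any of this; nothing here closes the crux; Schneider's non-degeneracy conjecture (barrier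
`Literature.Barriers.BirchSwinnertonDyer.PAdicHeightNondegeneracy`) is asserted NOWHERE; every application is ONE curve. On REST⁗ (`5 ∣ ∏c_ℓ`)
admissibility at a carrier `ℓ` with `c_ℓ = 5` forces a factor `5` in the certificate multiple `m`, so the first admissible point already sits
at depth two with `v₅(h(Q)) ≥ 3` (`h(5Q') = 25h(Q')`), one digit beyond the precision-three checker `certNonsplit_of_certDepthTwo`. At depth two
the analytic inputs of that checker are in fact exact to one digit more (`log_Ŵ` quadratic: `5⁻⁶`; `σ_q²(ch w) − w`: `5⁻⁸`), so the SAME argument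
with the residue `λ` taken mod `5⁴` (`625 ∣ −2ae'b + 25a₁a²e'² − 2λb²`) and the certificate **`625 ∤ λ⁸ − e'⁸`** decides `v₅(h(Q)) ≤ 3`. Used at
the TR members (SD ∩ REST⁗: `25 ∣ #Ш_an` AND `5 ∣ ∏c`) TR1 = 1610g1 ⊗ 5653 and TR2 = 665a1 ⊗ 6469 of crux 19624 (seat g7, kit j289832).
Theorems only (0 defs, 0 facts, no `native_decide`); route-free. References: [SteinWuthrich2013] §4.2; [MazurSteinTate2006] §1;
[SilvermanAEC2009] IV.6.4, VII.3.4; [Iwasawa1972PadicL] §4.4.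
-/

open scoped Classical

open Filter Topology PowerSeries IsUltrametricDist WeierstrassCurve Literature.NumberTheory.EllipticCurves
  Literature.NumberTheory.EllipticCurves.Rank1Residual
  Literature.NumberTheory.EllipticCurves.SteinWuthrich2013
  Summit.BirchSwinnertonDyer.Rank1Residual
  Summit.BirchSwinnertonDyer.Rank1Residual.X11b

namespace Summit.BirchSwinnertonDyer.Rank1Residual.X11b.RegMult.KernelCertFive

/-! ### §0 Plumbing in `ℚ₅` -/

/-- `‖5^k‖₅ = 1/5^k`. [folklore] -/
private theorem norm_five_pow₆ (k : ℕ) : ‖(5 : ℚ_[5]) ^ k‖ = 1 / (5 : ℝ) ^ k := by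
  rw [norm_pow, show (5 : ℚ_[5]) = ((5 : ℕ) : ℚ_[5]) by norm_cast, Padic.norm_p]; simp

/-- `‖25‖₅ = 5⁻²`. [folklore] -/
private theorem norm_twentyfive₀ : ‖(25 : ℚ_[5])‖ = 1 / 25 := by
  rw [show (25 : ℚ_[5]) = (5 : ℚ_[5]) ^ 2 by norm_num, norm_five_pow₆]; norm_num

/-- `‖625‖₅ = 5⁻⁴`. [folklore] -/
private theorem norm_sixtwentyfive₀ : ‖(625 : ℚ_[5])‖ = 1 / 625 := by
  rw [show (625 : ℚ_[5]) = (5 : ℚ_[5]) ^ 4 by norm_num, norm_five_pow₆]; norm_num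

/-- `x = a/e²` in lowest terms has `den x = e²`. [folklore] -/
private theorem den_eq_sq {a : ℤ} {e : ℕ} (he : e ≠ 0) (hcop : Nat.Coprime a.natAbs e) {x : ℚ}
    (hx : x = a / (e : ℚ) ^ 2) : x.den = e ^ 2 := by
  have hpos : (0 : ℤ) < ((e : ℕ) : ℤ) ^ 2 := by positivity
  have hcop2 : Nat.Coprime a.natAbs ((((e : ℕ) : ℤ) ^ 2).natAbs) := by
    rw [Int.natAbs_pow, Int.natAbs_natCast]; exact hcop.pow_right 2
  have h := Rat.den_div_eq_of_coprime hpos hcop2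
  have hx' : x = ((a : ℤ) : ℚ) / ((((e : ℕ) : ℤ) ^ 2 : ℤ) : ℚ) := by rw [hx]; push_cast; ring
  rw [← hx'] at h
  exact_mod_cast h

/-- `gcd(a, 5ᵏe') = 1 ⇒ 5 ∤ a` (`k ≥ 1`). [folklore] -/
private theorem not_five_dvd_of_coprime {a : ℤ} {e' k : ℕ} (hk : k ≠ 0) (hcop : Nat.Coprime a.natAbs (5 ^ k * e')) :
    ¬ (5 : ℤ) ∣ a := by
  intro h
  have h1 : 5 ∣ a.natAbs := Int.natCast_dvd.mp h
  have h2 : 5 ∣ Nat.gcd a.natAbs (5 ^ k * e') := Nat.dvd_gcd h1 (dvd_mul_of_dvd_left (dvd_pow_self 5 hk) e')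
  rw [hcop] at h2
  exact absurd (Nat.le_of_dvd one_pos h2) (by norm_num)

/-! ### §1 The precision-four height certificate at depth two -/

section Height

variable (W : WeierstrassCurve ℚ) {a₁ a₂ a₃ a₄ a₆ : ℤ} (hW : W = ⟨a₁, a₂, a₃, a₄, a₆⟩)

include hW in
/-- **The first-order REG5CERT certificate at DEPTH TWO to PRECISION FOUR** (decides `v₅(h(Q)) ≤ 3`; same analytic input as the
precision-three form — at depth two the quadratic logarithm is exact to `5⁻⁶` and the sigma function to `5⁻⁸`, one digit more than the
precision-three certificate uses). Let `W/ℚ` be globally minimal with integer model `⟨a₁,…,a₆⟩` whose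
`c₄, c₆` are `5`-adic units; let `Q = (x, y) = (a/e², b/e³)` with `e = 25e'`, `5 ∤ e'`, `5 ∤ b`, `gcd(a, e) = 1` (so `z(Q) = −ae/b`
has `‖z‖₅ = 5⁻²`); let `λ` be an integer with `625 ∣ −2ae'b + 25a₁a²e'² − 2λb²` (`log_Ŵ(z) ≡ z + a₁z²/2 ≡ 25λ (mod 5⁶)`) and `5 ∤ λ`.
If **`625 ∤ λ⁸ − e'⁸`** then `heightFourOneCoord W 5 q x y ≠ 0` for EVERY `‖q‖₅ < 1`: `h = log₅(den x) − log₅(C²σ²)` with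
`den x = 625e'²`, `C²σ² = log_Ŵ(z)²·(1 + O(5⁻⁴)) ≡ 625λ² (mod 625·5⁻⁴)`, and equal logarithms would force `5⁴ ∣ (λ²)⁴ − (e'²)⁴`
(`padicLog_ne_padicLog_of_unitResidue`, `P = 625`, `N = 4`). This is the variant needed when the first admissible multiple of the
generator lands at depth two WITH a factor `5` forced by a Tamagawa number `c_ℓ = 5` (REST⁗: the TR members of crux 19624). [cite: SteinWuthrich2013, §4.2]
[cite: Iwasawa1972PadicL, §4.4] [cite: SilvermanAEC2009, IV.6.4] -/
theorem heightFourOneCoord_ne_zero_of_certDepthTwoN4 [W.IsGloballyMinimal] {a b c4 c6 lam : ℤ} {e' : ℕ}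
    (hc4 : c4 = (a₁ ^ 2 + 4 * a₂) ^ 2 - 24 * (2 * a₄ + a₁ * a₃))
    (hc6 : c6 = -(a₁ ^ 2 + 4 * a₂) ^ 3 + 36 * (a₁ ^ 2 + 4 * a₂) * (2 * a₄ + a₁ * a₃) - 216 * (a₃ ^ 2 + 4 * a₆))
    (h5c4 : ¬ (5 : ℤ) ∣ c4) (h5c6 : ¬ (5 : ℤ) ∣ c6) (h5e : ¬ (5 : ℤ) ∣ e') (h5b : ¬ (5 : ℤ) ∣ b)
    (hcop : Nat.Coprime a.natAbs (25 * e'))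
    {x y : ℚ} (hx : x = a / ((25 * e' : ℕ) : ℚ) ^ 2) (hy : y = b / ((25 * e' : ℕ) : ℚ) ^ 3)
    (hlam : (625 : ℤ) ∣ -2 * a * e' * b + 25 * a₁ * a ^ 2 * e' ^ 2 - 2 * lam * b ^ 2) (h5lam : ¬ (5 : ℤ) ∣ lam)
    (hcert : ¬ (5 : ℤ) ^ 4 ∣ (lam ^ 2) ^ 4 - ((e' : ℤ) ^ 2) ^ 4)
    {q : ℚ_[5]} (hq : ‖q‖ < 1) : heightFourOneCoord W 5 q x y ≠ 0 := by
  have h5a : ¬ (5 : ℤ) ∣ a := not_five_dvd_of_coprime (k := 2) two_ne_zero (by simpa using hcop)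
  have he'0 : e' ≠ 0 := by rintro rfl; exact h5e (by simp)
  set V := W.baseChange ℚ_[5] with hV
  have ha1 : V.a₁ = a₁ := baseChange_a₁_eq W hW
  -- the parameter `z = −x/y = −25ae'/b`, `‖z‖ = 5⁻²`
  set z : ℚ_[5] := -(x : ℚ_[5]) / y with hz
  have hbn : ‖(b : ℚ_[5])‖ = 1 := norm_intCast_eq_one_of_not_dvd h5b
  have hb0 : (b : ℚ_[5]) ≠ 0 := by intro h; rw [h, norm_zero] at hbn; exact zero_ne_one hbn
  have hen : ‖((e' : ℤ) : ℚ_[5])‖ = 1 := norm_intCast_eq_one_of_not_dvd h5e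
  have he0 : ((e' : ℤ) : ℚ_[5]) ≠ 0 := by intro h; rw [h, norm_zero] at hen; exact zero_ne_one hen
  have he0' : (e' : ℚ_[5]) ≠ 0 := by exact_mod_cast he0
  have hae : ‖((-a * e' : ℤ) : ℚ_[5])‖ = 1 := by
    rw [Int.cast_mul, norm_mul, Int.cast_neg, norm_neg, norm_intCast_eq_one_of_not_dvd h5a, hen, one_mul]
  have hzval : z = 25 * ((-a * e' : ℤ) : ℚ_[5]) / (b : ℚ_[5]) := by
    have h50 : (25 : ℚ_[5]) ≠ 0 := by norm_num
    rw [hz, hx, hy]; push_cast; field_simp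
  have hzn : ‖z‖ = 1 / 25 := by rw [hzval, norm_div, norm_mul, norm_twentyfive₀, hae, hbn]; norm_num
  -- the formal logarithm to second order and the residue `λ`
  have hFL := norm_padicFormalLog_sub_quadratic_le V hzn.le
  rw [ha1] at hFL
  have hres : ‖(z + (2 : ℚ_[5])⁻¹ * (a₁ : ℚ_[5]) * z ^ 2) - 25 * (lam : ℚ_[5])‖ ≤ 1 / 5 ^ 6 := by
    have hid : (z + (2 : ℚ_[5])⁻¹ * (a₁ : ℚ_[5]) * z ^ 2) - 25 * (lam : ℚ_[5]) =
        25 * (((-2 * a * e' * b + 25 * a₁ * a ^ 2 * e' ^ 2 - 2 * lam * b ^ 2 : ℤ)) : ℚ_[5]) /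
          ((2 * b ^ 2 : ℤ) : ℚ_[5]) := by
      have h20 : (2 : ℚ_[5]) ≠ 0 := by norm_num
      rw [hzval]; push_cast; field_simp
    rw [hid, norm_div, norm_mul, norm_twentyfive₀]
    have hK : ‖(((-2 * a * e' * b + 25 * a₁ * a ^ 2 * e' ^ 2 - 2 * lam * b ^ 2 : ℤ)) : ℚ_[5])‖ ≤ 1 / 625 := by
      refine ((Padic.norm_int_le_pow_iff_dvd (p := 5) _ 4).mpr (by exact_mod_cast hlam)).trans ?_
      norm_num
    have hD : ‖((2 * b ^ 2 : ℤ) : ℚ_[5])‖ = 1 :=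
      norm_intCast_eq_one_of_not_dvd (by
        intro h
        have h2 : (5 : ℤ) ∣ b ^ 2 :=
          ((Int.prime_iff_natAbs_prime.mpr (by norm_num) : Prime (5 : ℤ)).dvd_or_dvd h).resolve_left (by norm_num)
        exact not_five_dvd_sq h5b h2)
    rw [hD, div_one]
    calc 1 / 25 * ‖(((-2 * a * e' * b + 25 * a₁ * a ^ 2 * e' ^ 2 - 2 * lam * b ^ 2 : ℤ)) : ℚ_[5])‖
        ≤ 1 / 25 * (1 / 625) := by gcongr
      _ = 1 / 5 ^ 6 := by norm_num
  have hL : ‖V.padicFormalLog z - 25 * (lam : ℚ_[5])‖ ≤ 1 / 5 ^ 6 := by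
    have : V.padicFormalLog z - 25 * (lam : ℚ_[5]) = (V.padicFormalLog z - (z + (2 : ℚ_[5])⁻¹ * (a₁ : ℚ_[5]) * z ^ 2)) +
        ((z + (2 : ℚ_[5])⁻¹ * (a₁ : ℚ_[5]) * z ^ 2) - 25 * (lam : ℚ_[5])) := by ring
    rw [this]
    exact (IsUltrametricDist.norm_add_le_max _ _).trans (max_le hFL hres)
  have hlamn : ‖(lam : ℚ_[5])‖ = 1 := norm_intCast_eq_one_of_not_dvd h5lam
  have h5lamn : ‖(25 * (lam : ℚ_[5]))‖ = 1 / 25 := by rw [norm_mul, norm_twentyfive₀, hlamn, mul_one]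
  have hLn : ‖V.padicFormalLog z‖ = 1 / 25 := by
    have hlt : ‖V.padicFormalLog z - 25 * (lam : ℚ_[5])‖ < ‖(25 * (lam : ℚ_[5]))‖ := by
      rw [h5lamn]; exact hL.trans_lt (by norm_num)
    rw [Padic.norm_eq_of_norm_sub_lt_right hlt, h5lamn]
  -- the sigma function: `C²σ² = L² + O(5⁻⁸)`, `L² = 625λ² + O(5⁻⁷)`
  set L := V.padicFormalLog z with hLdef
  set C2 := uniformisationScaleSq W 5 q with hC2def
  have hC2 : ‖C2‖ = 1 := norm_uniformisationScaleSq_eq_one_of_units W hW hc4 hc6 h5c4 h5c6 hq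
  have hC20 : C2 ≠ 0 := uniformisationScaleSq_ne_zero_of_units W hW hc4 hc6 h5c4 h5c6 hq
  have hwdef : logUnitParamSq W 5 q x y = L ^ 2 / C2 := by rw [logUnitParamSq]
  set w := logUnitParamSq W 5 q x y with hw
  have hwn : ‖w‖ ≤ 1 / 625 := by rw [hwdef, norm_div, norm_pow, hLn, hC2]; norm_num
  have hS := norm_tateSigmaSq_coshOfSq_sub_le hq hwn
  set S2 := tateSigmaSq q (coshOfSq w) with hS2
  have hCw : C2 * w = L ^ 2 := by rw [hwdef]; field_simp
  have hB1 : ‖C2 * S2 - L ^ 2‖ ≤ 1 / 5 ^ 8 := by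
    rw [← hCw, ← mul_sub, norm_mul, hC2, one_mul]; exact hS
  have hB2 : ‖L ^ 2 - (25 * (lam : ℚ_[5])) ^ 2‖ ≤ 1 / 5 ^ 8 := by
    rw [sq_sub_sq, norm_mul]
    have hplus : ‖L + 25 * (lam : ℚ_[5])‖ ≤ 1 / 25 :=
      (IsUltrametricDist.norm_add_le_max _ _).trans (max_le hLn.le h5lamn.le)
    calc ‖L + 25 * (lam : ℚ_[5])‖ * ‖L - 25 * (lam : ℚ_[5])‖ ≤ 1 / 25 * (1 / 5 ^ 6) := by gcongr
      _ = 1 / 5 ^ 8 := by norm_num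
  have hB : ‖C2 * S2 - 625 * (((lam ^ 2 : ℤ)) : ℚ_[5])‖ ≤ ‖(625 : ℚ_[5])‖ / (5 : ℝ) ^ 4 := by
    have hid : C2 * S2 - 625 * (((lam ^ 2 : ℤ)) : ℚ_[5]) = (C2 * S2 - L ^ 2) + (L ^ 2 - (25 * (lam : ℚ_[5])) ^ 2) := by
      push_cast; ring
    rw [hid, norm_sixtwentyfive₀]
    refine (IsUltrametricDist.norm_add_le_max _ _).trans (max_le (hB1.trans (by norm_num)) (hB2.trans (by norm_num)))
  -- `den x = e² = 625e'²`
  have hden : x.den = (25 * e') ^ 2 := den_eq_sq (by positivity) hcop hx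
  have hA : ‖(((x.den : ℚ)) : ℚ_[5]) - 625 * ((((e' : ℤ)) ^ 2 : ℤ) : ℚ_[5])‖ ≤ ‖(625 : ℚ_[5])‖ / (5 : ℝ) ^ 4 := by
    have h0 : (((x.den : ℚ)) : ℚ_[5]) - 625 * ((((e' : ℤ)) ^ 2 : ℤ) : ℚ_[5]) = 0 := by
      rw [hden]; push_cast; ring
    rw [h0, norm_zero]
    positivity
  -- the assembly
  intro h0
  rw [heightFourOneCoord] at h0
  have heq : padicLog 5 (((x.den : ℚ)) : ℚ_[5]) = padicLog 5 (C2 * S2) := sub_eq_zero.mp h0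
  exact padicLog_ne_padicLog_of_unitResidue (P := 625) (by norm_num) (not_five_dvd_sq h5e) (not_five_dvd_sq h5lam)
    (by norm_num : 1 ≤ 4) hA hB hcert heq

end Height

/-! ### §2 The admissible certificate from one row's integers -/

/-- **`RegMult.CertNonsplit W 5 Q 1` from a depth-two PRECISION-FOUR certificate** (`e = 25e'`; residue `625 ∣ −2ae'b + 25a₁a²e'² − 2λb²`;
certificate **`625 ∤ λ⁸ − e'⁸`**): as `certNonsplit_of_certDepthTwo`. Per curve; nothing class-wide. [cite: SteinWuthrich2013, §4.2]
[cite: MazurSteinTate2006, §1] [cite: SilvermanAEC2009, VII.3.4] -/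
theorem certNonsplit_of_certDepthTwoN4 (W : WeierstrassCurve ℚ) {a₁ a₂ a₃ a₄ a₆ : ℤ} (hW : W = ⟨a₁, a₂, a₃, a₄, a₆⟩)
    [W.IsElliptic] [W.IsGloballyMinimal] {a b c4 c6 lam : ℤ} {e' n : ℕ}
    (H : c4 = (a₁ ^ 2 + 4 * a₂) ^ 2 - 24 * (2 * a₄ + a₁ * a₃) ∧
      c6 = -(a₁ ^ 2 + 4 * a₂) ^ 3 + 36 * (a₁ ^ 2 + 4 * a₂) * (2 * a₄ + a₁ * a₃) - 216 * (a₃ ^ 2 + 4 * a₆) ∧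
      ¬ (5 : ℤ) ∣ c4 ∧ ¬ (5 : ℤ) ∣ c6 ∧ ¬ (5 : ℤ) ∣ e' ∧ ¬ (5 : ℤ) ∣ b ∧ Nat.Coprime a.natAbs (25 * e') ∧
      Int.gcd (2 * b + a₁ * a * (25 * e' : ℕ) + a₃ * (25 * e' : ℕ) ^ 3)
        (a₁ * b * (25 * e' : ℕ) - (3 * a ^ 2 + 2 * a₂ * a * (25 * e' : ℕ) ^ 2 + a₄ * (25 * e' : ℕ) ^ 4)) ∣ (25 * e') ^ n ∧
      (625 : ℤ) ∣ -2 * a * e' * b + 25 * a₁ * a ^ 2 * e' ^ 2 - 2 * lam * b ^ 2 ∧ ¬ (5 : ℤ) ∣ lam ∧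
      ¬ (5 : ℤ) ^ 4 ∣ (lam ^ 2) ^ 4 - ((e' : ℤ) ^ 2) ^ 4)
    {x y : ℚ} (hx : x = a / ((25 * e' : ℕ) : ℚ) ^ 2) (hy : y = b / ((25 * e' : ℕ) : ℚ) ^ 3)
    (h : W.toAffine.Nonsingular x y) : RegMult.CertNonsplit W 5 (.some x y h) 1 := by
  obtain ⟨hc4, hc6, h5c4, h5c6, h5e, h5b, hcop, hgcd, hlam, h5lam, hcert⟩ := H
  have he'0 : e' ≠ 0 := by rintro rfl; exact h5e (by simp)
  have he0 : (25 * e' : ℕ) ≠ 0 := by positivity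
  have hx1 : 1 < ‖(x : ℚ_[5])‖ :=
    (one_lt_norm_ratCast_iff 5 x).mpr (KernelCert.padicValRat_x_neg he0 hx hcop (dvd_mul_of_dvd_left (by norm_num) e'))
  have hadm : W.IsAdmissible 5 (.some x y h) :=
    isAdmissible_of_one_lt_norm (by norm_num) h hx1 (KernelCert.hasNonsingularReductionAt_of_gcd W hW he0 hx hy hcop hgcd)
  refine ⟨by rw [one_smul]; exact hadm, fun q _ hq1 _ => ?_⟩
  rw [one_smul]
  exact heightFourOneCoord_ne_zero_of_certDepthTwoN4 W hW hc4 hc6 h5c4 h5c6 h5e h5b hcop hx hy hlam h5lam hcert hq1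

end Summit.BirchSwinnertonDyer.Rank1Residual.X11b.RegMult.KernelCertFive
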